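import Summits.ResolutionOfSingularities.ResolutionOfSingularities.Theorems.AbhyankarShadowsShadowsUniformizeLurelDiscrete
import Literature.AlgebraicGeometry.Resolution.CompositeValuations
import Literature.AlgebraicGeometry.Resolution.RankOneReductionProofs
import Literature.AlgebraicGeometry.Resolution.SubfieldTransport
import HarnessLib

/-!
# The residue side of a composite valuation, discrete case (`stub_composite_residue_discrete`)

Stub of the birth line of the crux `ShadowsUniformize` (stmt-ResolutionOfSingularities-16756, route
`AbhyankarShadows`), composite-discrete branch. In the Novacoski–Spivakovsky decomposition
`ν = ν₁ ∘ ν₂` of a rational valuation ring `O` of a function field `K/k` (`k` algebraically closed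
of characteristic `p`) along a coarsening `O ≤ O₁`, the residue valuation `ν₂` has valuation ring
`O₂ := O / m_{O₁} = residueValuationSubring O O₁ hO` inside the residue field `κ(O₁)`. The
composition lemma (`stub_lurel_of_composite`) hands over an abstract field `κ` with a `k`-algebra
structure and a `k`-compatible SURJECTIVE (hence bijective) homomorphism `ι : κ → κ(O₁)`, and asks
for relative local uniformization of the valuation ring `O₂' := ι⁻¹(O₂)` of `κ` over `k`.

When the value group of `O₂` is CYCLIC this is the landed discrete branch
`lurelRational_of_isCyclic_valueGroup` (Knaf–Kuhlmann 2009, Thm. 1.5 with `P|_K = id`,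
`AbhyankarShadowsShadowsUniformizeLurelDiscrete.lean`) applied to `(κ, O₂')`; this file checks its
four hypotheses:

* `fg_top_of_surjective` — `κ | k` is finitely generated: `κ(O₁)` is generated over `k` by the
  residues of finitely many elements of `O` (hypothesis `hgen`), and `ι` is a bijection;
* `algebraMap_mem_comap_residueValuationSubring` — `k ⊆ O₂'`;
* `exists_valuation_comap_residue_sub_algebraMap_lt_one` — `O₂'` is rational: every `x ∈ O₂'` is
  congruent to a constant (from the rationality of `O` through `valuation_lt_one_iff_residue` and
  `valuation_map_lt_one_iff`);
* `exists_valuation_eq_zpow_of_isCyclic`, `exists_valuation_comap_eq_zpow`,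
  `isCyclic_of_valuation_eq_zpow` — `(O₂'.ValueGroup)ˣ` is cyclic: a generator `v t` of the value
  group of `O₂` pulls back to a generator `v (ι⁻¹ t)` of the value group of `O₂'`
  (`valuation_map_eq_iff`).

No named facts are used.

## Sources

* [KK09] H. Knaf, F.-V. Kuhlmann, *Every place admits local uniformization in a finite extension
  of the function field*, Adv. Math. 221 (2009) 428–453: Thm. 1.5. [KnafKuhlmann2009]
* [NS14] J. Novacoski, M. Spivakovsky, *Reduction of local uniformization to the rank one case*,
  2014: §2.1, Remark 2.4 (the decomposition `ν = ν₁ ∘ ν₂`). [NovacoskiSpivakovsky2014]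
-/

noncomputable section

-- single-problem summit: the doubled namespace component is forced
set_option linter.dupNamespace false

open Literature.AlgebraicGeometry.Resolution IsLocalRing

namespace Summit.ResolutionOfSingularities.ResolutionOfSingularities.Theorems

/-! ## Cyclic value groups and generators -/

/-- **A generator of a cyclic value group.** If `(O.ValueGroup)ˣ` is cyclic, there is `t ≠ 0` in
`K` such that every non-zero value is an integer power of `v t` (for the trivial valuation ring
`v t = 1`). [folklore] -/
theorem exists_valuation_eq_zpow_of_isCyclic {K : Type} [Field K] (O : ValuationSubring K)
    (hcyc : IsCyclic (O.ValueGroup)ˣ) :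
    ∃ t : K, t ≠ 0 ∧ ∀ y : K, y ≠ 0 → ∃ m : ℤ, O.valuation y = O.valuation t ^ m := by
  obtain ⟨g, hg⟩ := hcyc.exists_generator
  obtain ⟨t, ht⟩ := O.valuation_surjective (g : O.ValueGroup)
  have ht0 : t ≠ 0 := by
    intro h0
    rw [h0, map_zero] at ht
    exact g.ne_zero ht.symm
  refine ⟨t, ht0, fun y hy0 => ?_⟩
  obtain ⟨m, hm⟩ := Subgroup.mem_zpowers_iff.mp
    (hg (Units.mk0 (O.valuation y) ((map_ne_zero O.valuation).mpr hy0)))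
  refine ⟨m, ?_⟩
  have := congrArg Units.val hm
  rw [Units.val_zpow_eq_zpow_val] at this
  rw [ht]
  simpa using this.symm

/-- **Cyclicity from a generator.** If `t ≠ 0` and every non-zero value is an integer power of
`v t`, then `(O.ValueGroup)ˣ` is cyclic, generated by `v t` (every unit of the value group is a
value, `ValuationSubring.valuation_surjective`). [folklore] -/
theorem isCyclic_of_valuation_eq_zpow {K : Type} [Field K] (O : ValuationSubring K) (t : K)
    (ht0 : t ≠ 0) (h : ∀ y : K, y ≠ 0 → ∃ m : ℤ, O.valuation y = O.valuation t ^ m) :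
    IsCyclic (O.ValueGroup)ˣ := by
  refine ⟨⟨Units.mk0 (O.valuation t) ((map_ne_zero O.valuation).mpr ht0), fun u => ?_⟩⟩
  obtain ⟨y, hy⟩ := O.valuation_surjective (u : O.ValueGroup)
  have hy0 : y ≠ 0 := by
    intro h0
    rw [h0, map_zero] at hy
    exact u.ne_zero hy.symm
  obtain ⟨m, hm⟩ := h y hy0
  refine ⟨m, ?_⟩
  dsimp only
  ext
  rw [Units.val_zpow_eq_zpow_val, Units.val_mk0, ← hm, hy]

/-- **Discreteness is transported along a field isomorphism.** For a surjective homomorphism of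
fields `ι : κ → L` and a valuation ring `V` of `L`: if every non-zero `V`-value is an integer
power of `v t`, `t ≠ 0`, then every non-zero `ι⁻¹(V)`-value is an integer power of the value of a
preimage `t'` of `t` (the valuations `V.valuation ∘ ι` and `(ι⁻¹ V).valuation` are equivalent,
`valuation_map_eq_iff`). [folklore] -/
theorem exists_valuation_comap_eq_zpow {κ L : Type} [Field κ] [Field L] (ι : κ →+* L)
    (hι : Function.Surjective ι) (V : ValuationSubring L) (t : L) (ht0 : t ≠ 0)
    (h : ∀ y : L, y ≠ 0 → ∃ m : ℤ, V.valuation y = V.valuation t ^ m) :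
    ∃ t' : κ, t' ≠ 0 ∧
      ∀ y : κ, y ≠ 0 → ∃ m : ℤ, (V.comap ι).valuation y = (V.comap ι).valuation t' ^ m := by
  obtain ⟨t', rfl⟩ := hι t
  have ht'0 : t' ≠ 0 := fun h0 => ht0 (by rw [h0, map_zero])
  refine ⟨t', ht'0, fun y hy0 => ?_⟩
  obtain ⟨m, hm⟩ := h (ι y) ((map_ne_zero ι).mpr hy0)
  refine ⟨m, ?_⟩
  have h1 : V.valuation (ι y) = V.valuation (ι (t' ^ m)) := by
    rw [map_zpow₀, map_zpow₀]
    exact hm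
  rw [← map_zpow₀]
  exact (valuation_map_eq_iff ι (rfl : V.comap ι = V.comap ι) y (t' ^ m)).mp h1

/-! ## Finite generation through a `k`-compatible field isomorphism -/

/-- **Finite generation of `κ | k`.** If `ι : κ → L` is a surjective homomorphism of fields and
`L` is generated, as a field, by `ι(k)` and finitely many elements `g s` (`s ∈ S`), then the
preimages of the `g s` generate `κ` over `k`: the image under `ι` of the subfield they generate
contains `ι(k)` and the `g s`, hence is all of `L`, and `ι` is injective. [folklore] -/
theorem fg_top_of_surjective {k κ L σ : Type} [Field k] [Field κ] [Field L] [Algebra k κ]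
    (ι : κ →+* L) (hι : Function.Surjective ι) (S : Finset σ) (g : σ → L)
    (hS : ∀ T : Subfield L, (∀ c : k, ι (algebraMap k κ c) ∈ T) → (∀ s ∈ S, g s ∈ T) → T = ⊤) :
    (⊤ : IntermediateField k κ).FG := by
  classical
  refine ⟨S.image (Function.surjInv hι ∘ g), ?_⟩
  set F : IntermediateField k κ :=
    IntermediateField.adjoin k ((S.image (Function.surjInv hι ∘ g) : Finset κ) : Set κ) with hF
  -- the image of `F` under `ι` is a subfield of `L` containing `ι(k)` and the generators
  have hT : F.toSubfield.map ι = ⊤ := by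
    refine hS _ (fun c => ?_) (fun s hs => ?_)
    · exact Subfield.mem_map.mpr ⟨_, F.algebraMap_mem c, rfl⟩
    · refine Subfield.mem_map.mpr ⟨Function.surjInv hι (g s), ?_, Function.surjInv_eq hι (g s)⟩
      exact IntermediateField.subset_adjoin k _
        (Finset.mem_coe.mpr (Finset.mem_image_of_mem (Function.surjInv hι ∘ g) hs))
  refine top_le_iff.mp fun x _ => ?_
  have hx : ι x ∈ F.toSubfield.map ι := by
    rw [hT]
    exact Subfield.mem_top _
  obtain ⟨y, hy, hxy⟩ := Subfield.mem_map.mp hx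
  rw [← ι.injective hxy]
  exact hy

/-! ## The residue valuation ring read through `ι` -/

section residueSide

variable {k K κ : Type} [Field k] [Field K] [Algebra k K] [Field κ] [Algebra k κ]
  (O O₁ : ValuationSubring K) (hO : O ≤ O₁) (hk : ∀ c : k, algebraMap k K c ∈ O)
  (ι : κ →+* ResidueField O₁)
  (hιk : ∀ c : k, ι (algebraMap k κ c) = residue O₁ ⟨algebraMap k K c, hO (hk c)⟩)

include hιk in
/-- **Constants lie in `ι⁻¹(O / m_{O₁})`.** For `c ∈ k`, `ι c` is the residue of the element
`c ∈ O`, hence lies in `O / m_{O₁}` (`residue_mem_residueValuationSubring_iff`). [folklore] -/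
theorem algebraMap_mem_comap_residueValuationSubring (c : k) :
    algebraMap k κ c ∈ (residueValuationSubring O O₁ hO).comap ι := by
  rw [ValuationSubring.mem_comap, hιk]
  exact (residue_mem_residueValuationSubring_iff O O₁ hO _).mpr (hk c)

include hιk in
/-- **Rationality of `ι⁻¹(O / m_{O₁})`.** If every element of `O` is congruent to a constant
modulo `m_O`, then every element `x` of `ι⁻¹(O / m_{O₁})` is congruent to a constant modulo its
maximal ideal: `ι x` is the residue of some `a ∈ O`, `a ≡ c (mod m_O)`, and
`v_O (a - c) < 1 ↔ v_{O/m_{O₁}} (residue (a - c)) < 1` (`valuation_lt_one_iff_residue`) while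
`residue (a - c) = ι (x - c)`; finally values `< 1` are read through `ι`
(`valuation_map_lt_one_iff`). [folklore] -/
theorem exists_valuation_comap_residue_sub_algebraMap_lt_one
    (hrat : ∀ x : K, x ∈ O → ∃ c : k, O.valuation (x - algebraMap k K c) < 1)
    (x : κ) (hx : x ∈ (residueValuationSubring O O₁ hO).comap ι) :
    ∃ c : k, ((residueValuationSubring O O₁ hO).comap ι).valuation (x - algebraMap k κ c) < 1 := by
  obtain ⟨a, ha⟩ := (mem_residueValuationSubring_iff O O₁ hO (ι x)).mp
    (ValuationSubring.mem_comap.mp hx)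
  obtain ⟨c, hc⟩ := hrat (a : K) a.2
  refine ⟨c, ?_⟩
  have hmem : (a : K) - algebraMap k K c ∈ O := O.sub_mem a.2 (hk c)
  have h1 := (valuation_lt_one_iff_residue O O₁ hO _ hmem).mp hc
  have h2 : residue O₁ ⟨(a : K) - algebraMap k K c, hO hmem⟩ = ι (x - algebraMap k κ c) := by
    rw [map_sub, hιk, ← ha, ← map_sub]
    congr 1
  rw [h2] at h1
  exact (valuation_map_lt_one_iff ι
    (rfl : (residueValuationSubring O O₁ hO).comap ι = (residueValuationSubring O O₁ hO).comap ι)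
    _).mp h1

end residueSide

/-! ## The stub -/

/-- **STUB (the residue side, discrete case).** For `k ⊆ O ≤ O₁` in `K` with `O` rational over the
algebraically closed `k`, `κ(O₁)` generated over `k` by residues of finitely many elements of `O`,
and the residue valuation ring `O₂ = O / m_{O₁}` of CYCLIC value group: through any `k`-compatible
surjective (hence bijective) `ι : κ → κ(O₁)`, the valuation ring `ι⁻¹(O₂)` of `κ` admits relative
local uniformization over `k` — `κ/k` is finitely generated (`fg_top_of_surjective`), `ι⁻¹(O₂)`
contains `k` and is rational (`exists_valuation_comap_residue_sub_algebraMap_lt_one`) with cyclic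
value group (`exists_valuation_comap_eq_zpow`, `isCyclic_of_valuation_eq_zpow`), so
`lurelRational_of_isCyclic_valueGroup` (landed, c1) applies. [cite: KnafKuhlmann2009, Thm. 1.5] -/
theorem stub_composite_residue_discrete (p : ℕ) (hp : p.Prime) (k K : Type) [Field k] [CharP k p]
    [IsAlgClosed k] [Field K] [Algebra k K] (O O₁ : ValuationSubring K) (hO : O ≤ O₁)
    (hk : ∀ c : k, algebraMap k K c ∈ O)
    (hrat : ∀ x : K, x ∈ O → ∃ c : k, O.valuation (x - algebraMap k K c) < 1)
    (hgen : ∃ S : Finset O, ∀ T : Subfield (IsLocalRing.ResidueField O₁),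
      (∀ c : k, IsLocalRing.residue O₁ ⟨algebraMap k K c, hO (hk c)⟩ ∈ T) →
      (∀ s ∈ S, IsLocalRing.residue O₁ ⟨(s : K), hO s.2⟩ ∈ T) → T = ⊤)
    (hcyc : IsCyclic ((residueValuationSubring O O₁ hO).ValueGroup)ˣ)
    (κ : Type) [Field κ] [Algebra k κ] (ι : κ →+* IsLocalRing.ResidueField O₁)
    (hι : Function.Surjective ι)
    (hιk : ∀ c : k, ι (algebraMap k κ c) = IsLocalRing.residue O₁ ⟨algebraMap k K c, hO (hk c)⟩)
    (R : Subalgebra k κ) (hR : R.FG)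
    (hRO : R.toSubring ≤ ((residueValuationSubring O O₁ hO).comap ι).toSubring) :
    ∃ (B : Subalgebra k κ) (hB : B.toSubring ≤ ((residueValuationSubring O O₁ hO).comap ι).toSubring),
      R ≤ B ∧ B.FG ∧ IsRegularLocalRing (Localization.AtPrime (Ideal.comap (Subring.inclusion hB)
        (IsLocalRing.maximalIdeal ((residueValuationSubring O O₁ hO).comap ι)))) := by
  classical
  -- (i) `κ | k` is finitely generated
  obtain ⟨S, hS⟩ := hgen
  have hfg : (⊤ : IntermediateField k κ).FG :=
    fg_top_of_surjective ι hι S (fun s : O => residue O₁ ⟨(s : K), hO s.2⟩)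
      (fun T h₁ h₂ => hS T (fun c => by rw [← hιk]; exact h₁ c) h₂)
  -- (ii) constants
  have hk' : ∀ c : k, algebraMap k κ c ∈ (residueValuationSubring O O₁ hO).comap ι :=
    algebraMap_mem_comap_residueValuationSubring O O₁ hO hk ι hιk
  -- (iii) rationality
  have hrat' : ∀ x : κ, x ∈ (residueValuationSubring O O₁ hO).comap ι →
      ∃ c : k, ((residueValuationSubring O O₁ hO).comap ι).valuation (x - algebraMap k κ c) < 1 :=
    exists_valuation_comap_residue_sub_algebraMap_lt_one O O₁ hO hk ι hιk hrat
  -- (iv) cyclic value group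
  have hcyc' : IsCyclic (((residueValuationSubring O O₁ hO).comap ι).ValueGroup)ˣ := by
    obtain ⟨t, ht0, ht⟩ := exists_valuation_eq_zpow_of_isCyclic _ hcyc
    obtain ⟨t', ht'0, ht'⟩ := exists_valuation_comap_eq_zpow ι hι _ t ht0 ht
    exact isCyclic_of_valuation_eq_zpow _ t' ht'0 ht'
  obtain ⟨B, hB, hRB, hBfg, -, hreg⟩ :=
    lurelRational_of_isCyclic_valueGroup p hp k κ hfg _ hk' hrat' hcyc' R hR hRO
  exact ⟨B, hB, hRB, hBfg, hreg⟩

end Summit.ResolutionOfSingularities.ResolutionOfSingularities.Theorems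

end
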